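import Literature.Topology.FourManifolds.PLStructuresExistenceReduction
import Literature.Topology.FourManifolds.CellTriangulation
import HarnessLib

/-!
# Towards `PLStructures.lean` (spc4.S35, existence half): reduction to the simplexwise step

Fourth proof file for the named fact
`Literature.Topology.FourManifolds.exists_isManifold_isWhiteheadCompatible_four` of
`Literature/Topology/FourManifolds/PLStructures.lean` (smoothings of PL `4`-manifolds exist;
Hirsch–Mazur (1974), Part I, §3 and Part II, §5), after `PLStructuresProofs.lean`,
`PLStructuresExistenceProofs.lean` and `PLStructuresExistenceReduction.lean` (which reduces the
fact to the *local step* in `ℝⁿ`: smoothing families of open subsets of `ℝⁿ` extend from a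
compact set over a compact set with prescribed compact support).  The fact is NOT discharged
here.  This file reduces the local step, sorry-free and without introducing any definition or
named fact, to the **simplexwise step** (hypothesis `hsimp`, stated inline):

> for a simplex `conv s` of positive dimension in `ℝⁿ` and a smoothing family `A` covering its
> boundary `⋃_{t ⊊ s} conv t` (a set of partial homeomorphisms of `ℝⁿ`, each piecewise
> differentiable of maximal rank on its source, with `C^∞` transition maps), there are an open
> neighbourhood `U'` of the boundary and a smoothing family `B ⊇ {a|U' : a ∈ A}` covering
> `conv s`

— the smoothing near the boundary of a simplex, possibly shrunk, extends over the simplex.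
This is where the obstruction theory lives.  For `n = 4` (indeed `n ≤ 7`) it holds by the
relative smoothing theorem of Hirsch–Mazur, Part II, §5 (Thm. 5.3 and the remark following
it): for a closed subset `A` of a PL manifold `M` and a smoothing `α` of a neighbourhood of
`A`, the obstructions to extending the `A`-germ of `α` over `M` lie in
`Hⁱ(M, A; πᵢ₋₁(PL/O))`, and `PL/O` is `6`-connected (`Γ₁ = Γ₂ = 0`, `Γ₃ = 0` by Smale 1959 /
Munkres 1960, `Γ₄ = 0` by Cerf, `Γ₅ = Γ₆ = 0` by Kervaire–Milnor) — apply it to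
`M = V ∪ T`, `V` the open set smoothed by `A`-charts and `T` a thin open neighbourhood of the
simplex, with `A = M ∖ (T ∖ cl U₀)` for a neighbourhood `U₀ ⋐ V` of the boundary.  None of
this is proved here.  (Munkres, *Obstructions to imposing differentiable structures*, Illinois
J. Math. 8 (1964), §1, runs an induction of the same skeletal shape with coefficients `Γᵢ`,
but the smoothings it produces are not compatible with the triangulation — loc. cit.,
introduction — so it is a model for the bookkeeping only.)  Vertices are free
(`simplexStep_of_card_eq_one`).

* §1 Dominated charts: a chart which is a restriction-in-values of another
  (`b.source ⊆ a.source`, `b = a` on `b.source`) has `b.symm = a.symm` on `b.target`; families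
  of charts dominated by members of a compatible family are compatible
  (`groupoidCompatible_of_dominated`), dominated charts of PD charts are PD; iterated
  restrictions.
* §2 `exists_complex_fine`: a finite simplicial complex around a compact `L` inside an open
  `O`, every closed simplex of which meeting a compact `K` lies in a given open `V ⊇ K`
  (`exists_complex_of_local` of `CellTriangulation.lean`).
* §3 `exists_family_simplex_step`: the step over one simplex `σ` meeting the covered closed set
  `C` only along `∂σ ⊆ C`: apply `hsimp`, keep the old charts off
  `E = cthickening δ σ ∖ U'` and add the new ones restricted to `thickening δ σ`, with `δ` so
  small that `cthickening δ σ` misses `C ∖ U'` and stays inside the support.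
* §4 `localStep_of_simplexStep`: the local step (hypothesis `hloc` of
  `exists_isManifold_isWhiteheadCompatible_of_localStep`) from `hsimp`: with a fine complex `P`
  (`L ⊆ |P| ⊆ interior N`, closed simplices meeting `K` inside `V = ⋃ sources`), the simplices
  inside `V` are covered from the start and the others are processed by increasing dimension;
  such a simplex misses `K` and meets the other relevant simplices in proper faces, so it meets
  the covered set only along its boundary; the original charts survive off closed subsets of
  `interior N`, and their restrictions to `Nᶜ` are added at the end (an induction over the
  simplices outside the already smoothed region, of the shape of Munkres (1964), §1).
* §5 `simplexStep_of_card_eq_one` (vertices), `simplexStep_of_two_le`,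
  `exists_isManifold_isWhiteheadCompatible_of_simplexStep` (any `n`) and
  `exists_isManifold_isWhiteheadCompatible_four_of_simplexStep`: spc4.S35 (existence) follows
  from the simplexwise step in `ℝ⁴` for simplices of dimension `1 ≤ k ≤ 4`.

## References

* M. W. Hirsch, B. Mazur, *Smoothings of piecewise linear manifolds*, Ann. of Math. Studies 80,
  Princeton (1974): Part I, §3; Part II, §5, Thm. 5.3 and the remark following it.
  [HirschMazur1974]
* J. R. Munkres, *Obstructions to imposing differentiable structures*, Illinois J. Math. 8
  (1964), 361–376, introduction and §1 (held: `paper:munkres1964-…`, pp. 361–363).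
  [Munkres1964]
* J. R. Munkres, *Elementary differential topology*, Ann. of Math. Studies 54 (1966), §8, 10.2.
  [Munkres1966]
-/

open scoped Manifold ContDiff Topology
open Set Function Metric

noncomputable section

namespace Literature.Topology.FourManifolds

open _root_.Topology

/-! ### §1 Dominated charts -/

section Dominated

variable {H : Type*} [TopologicalSpace H] {M : Type*} [TopologicalSpace M]
  (G : StructureGroupoid H)

/-- If `b` is dominated by `a` (`b.source ⊆ a.source` and `b = a` on `b.source`), then
`b.target ⊆ a.target` and `b.symm = a.symm` on `b.target`. [folklore] -/
theorem target_subset_and_symm_eqOn_of_eqOn {b a : OpenPartialHomeomorph M H}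
    (hs : b.source ⊆ a.source) (heq : EqOn b a b.source) :
    b.target ⊆ a.target ∧ EqOn b.symm a.symm b.target := by
  have key : ∀ y ∈ b.target, a (b.symm y) = y := fun y hy => by
    rw [← heq (b.map_target hy), b.right_inv hy]
  refine ⟨fun y hy => ?_, fun y hy => ?_⟩
  · rw [← key y hy]
    exact a.map_source (hs (b.map_target hy))
  · calc b.symm y = a.symm (a (b.symm y)) := (a.left_inv (hs (b.map_target hy))).symm
      _ = a.symm y := by rw [key y hy]

/-- **A family of charts each dominated by a member of a `G`-compatible family is
`G`-compatible** (`G` closed under restriction): the transition map of two dominated charts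
agrees on its source with the transition map of the dominating ones
(`mem_groupoid_of_eqOn_of_source_subset`). [folklore] -/
theorem groupoidCompatible_of_dominated [ClosedUnderRestriction G]
    {A B : Set (OpenPartialHomeomorph M H)} (hA : ∀ e ∈ A, ∀ e' ∈ A, e.symm ≫ₕ e' ∈ G)
    (hB : ∀ b ∈ B, ∃ a ∈ A, b.source ⊆ a.source ∧ EqOn b a b.source) :
    ∀ b ∈ B, ∀ b' ∈ B, b.symm ≫ₕ b' ∈ G := by
  intro b hb b' hb'
  obtain ⟨a, ha, hs, heq⟩ := hB b hb
  obtain ⟨a', ha', hs', heq'⟩ := hB b' hb'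
  obtain ⟨ht, hsymm⟩ := target_subset_and_symm_eqOn_of_eqOn hs heq
  refine mem_groupoid_of_eqOn_of_source_subset G (hA a ha a' ha') (fun y hy => ?_) fun y hy => ?_
  · simp only [OpenPartialHomeomorph.trans_source, OpenPartialHomeomorph.symm_source,
      mem_inter_iff, mem_preimage] at hy ⊢
    refine ⟨ht hy.1, ?_⟩
    rw [← hsymm hy.1]
    exact hs' hy.2
  · simp only [OpenPartialHomeomorph.trans_source, OpenPartialHomeomorph.symm_source,
      mem_inter_iff, mem_preimage] at hy
    show b' (b.symm y) = a' (a.symm y)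
    rw [heq' hy.2, hsymm hy.1]

/-- A restriction is dominated by the chart. [folklore] -/
theorem restr_source_subset_and_eqOn (e : OpenPartialHomeomorph M H) (O : Set M) :
    (e.restr O).source ⊆ e.source ∧ EqOn (e.restr O) e (e.restr O).source :=
  ⟨fun x hx => by
    rw [OpenPartialHomeomorph.restr_source] at hx
    exact hx.1, fun _ _ => rfl⟩

/-- Iterated restriction to open sets. [folklore] -/
theorem restr_restr_of_isOpen (e : OpenPartialHomeomorph M H) {O O' : Set M} (hO : IsOpen O)
    (hO' : IsOpen O') : (e.restr O).restr O' = e.restr (O ∩ O') :=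
  OpenPartialHomeomorph.ext _ _ (fun _ => rfl) (fun _ => rfl) (by
    rw [(e.restr O).restr_source' _ hO', e.restr_source' _ hO, e.restr_source' _ (hO.inter hO'),
      inter_assoc])

end Dominated

section PDDominated

variable {n : ℕ}

/-- A chart dominated by a chart which is PD on its source is PD on its source. [folklore] -/
theorem isPDOn_source_of_eqOn
    {b a : OpenPartialHomeomorph (EuclideanSpace ℝ (Fin n)) (EuclideanSpace ℝ (Fin n))}
    (ha : IsPDOn n a a.source) (hs : b.source ⊆ a.source) (heq : EqOn b a b.source) :
    IsPDOn n b b.source :=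
  (ha.mono b.open_source hs).congr fun _ hx => heq hx

end PDDominated

/-! ### §2 Fine finite complexes -/

section Fine

variable {n : ℕ}

/-- **A fine finite complex around a compact set.**  For compact `K ⊆ V` open and compact
`L ⊆ O` open in `ℝⁿ`, there is a finite simplicial complex with `L` in the interior of its
underlying space, underlying space inside `O`, and every closed simplex meeting `K` contained
in `V` (`exists_complex_of_local` of `CellTriangulation.lean` with this "good" property, which
holds for all simplices of a small complex around a point of `V`, resp. of `Kᶜ`).
[cite: Munkres1966, 10.2] -/
theorem exists_complex_fine {K V L O : Set (EuclideanSpace ℝ (Fin n))} (hK : IsCompact K)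
    (hV : IsOpen V) (hKV : K ⊆ V) (hL : IsCompact L) (hO : IsOpen O) (hLO : L ⊆ O) :
    ∃ P : Geometry.SimplicialComplex ℝ (EuclideanSpace ℝ (Fin n)), P.faces.Finite ∧
      L ⊆ interior P.space ∧ P.space ⊆ O ∧
      ∀ t ∈ P.faces, (convexHull ℝ (t : Set (EuclideanSpace ℝ (Fin n))) ∩ K).Nonempty →
        convexHull ℝ (t : Set (EuclideanSpace ℝ (Fin n))) ⊆ V := by
  have hlocal : ∀ a ∈ L, ∃ Q : Geometry.SimplicialComplex ℝ (EuclideanSpace ℝ (Fin n)),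
      Q.faces.Finite ∧ Q.space ∈ 𝓝 a ∧ Q.space ⊆ O ∧ ∀ t ∈ Q.faces,
        (convexHull ℝ (t : Set (EuclideanSpace ℝ (Fin n))) ∩ K).Nonempty →
          convexHull ℝ (t : Set (EuclideanSpace ℝ (Fin n))) ⊆ V := by
    intro a haL
    by_cases haV : a ∈ V
    · obtain ⟨Q, hQfin, hQa, hQsub⟩ := exists_simplicialComplex_space_mem_nhds_subset
        (Filter.inter_mem (hO.mem_nhds (hLO haL)) (hV.mem_nhds haV))
      exact ⟨Q, hQfin, hQa, hQsub.trans inter_subset_left, fun t ht _ =>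
        (Geometry.SimplicialComplex.convexHull_subset_space ht).trans
          (hQsub.trans inter_subset_right)⟩
    · have haK : a ∉ K := fun h => haV (hKV h)
      obtain ⟨Q, hQfin, hQa, hQsub⟩ := exists_simplicialComplex_space_mem_nhds_subset
        (Filter.inter_mem (hO.mem_nhds (hLO haL)) (hK.isClosed.isOpen_compl.mem_nhds haK))
      refine ⟨Q, hQfin, hQa, hQsub.trans inter_subset_left, fun t ht hne => ?_⟩
      obtain ⟨x, hx, hxK⟩ := hne
      exact absurd hxK (hQsub ((Geometry.SimplicialComplex.convexHull_subset_space ht) hx)).2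
  obtain ⟨P, hfin, hLint, hPO, hgood, -⟩ := exists_complex_of_local
    (E := EuclideanSpace ℝ (Fin n))
    (Good := fun t => (convexHull ℝ (t : Set (EuclideanSpace ℝ (Fin n))) ∩ K).Nonempty →
      convexHull ℝ (t : Set (EuclideanSpace ℝ (Fin n))) ⊆ V)
    (fun s t hts hs hne => hts.trans (hs (hne.mono (inter_subset_inter_left K hts)))) hL
    hlocal (ι₀ := Fin 0) (fun i => i.elim0)
  exact ⟨P, hfin, hLint, hPO, hgood⟩

end Fine

/-! ### §3 The step over one simplex -/

section SimplexStep

variable {n : ℕ}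

/-- **Extending a smoothing family over one simplex.**  Let `A'` be a `C^∞`-compatible family
of PD charts of `ℝⁿ` covering a closed set `C`, and `s` a simplex whose boundary lies in `C`
and which meets `C` only along its boundary, inside an open set `N₀`.  Granted the simplexwise
extension (`hsimp`: a smoothing family covering the boundary of a simplex agrees, near the
boundary, with one covering the simplex), there is a compatible family of PD charts covering
`C ∪ conv s` which contains the restrictions of the members of `A'` to the complement of a
closed set `E ⊆ N₀` disjoint from `C`: keep the old charts off
`E = cthickening δ (conv s) ∖ U'` and add the new charts restricted to `thickening δ (conv s)`,
`δ` so small that the closed thickening misses `C ∖ U'` and stays in `N₀`. [folklore] -/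
theorem exists_family_simplex_step
    (hsimp : ∀ s : Finset (EuclideanSpace ℝ (Fin n)), s.Nonempty →
      AffineIndependent ℝ ((↑) : s → EuclideanSpace ℝ (Fin n)) →
      ∀ A : Set (OpenPartialHomeomorph (EuclideanSpace ℝ (Fin n)) (EuclideanSpace ℝ (Fin n))),
        (∀ a ∈ A, ∀ a' ∈ A, a.symm ≫ₕ a' ∈ contDiffGroupoid ∞ (𝓡 n)) →
        (∀ a ∈ A, IsPDOn n a a.source) →
        (⋃ t ∈ s.ssubsets, convexHull ℝ (t : Set (EuclideanSpace ℝ (Fin n)))) ⊆ ⋃ a ∈ A, a.source →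
        ∃ U' : Set (EuclideanSpace ℝ (Fin n)), IsOpen U' ∧
          (⋃ t ∈ s.ssubsets, convexHull ℝ (t : Set (EuclideanSpace ℝ (Fin n)))) ⊆ U' ∧
          ∃ B : Set (OpenPartialHomeomorph (EuclideanSpace ℝ (Fin n)) (EuclideanSpace ℝ (Fin n))),
            (∀ b ∈ B, ∀ b' ∈ B, b.symm ≫ₕ b' ∈ contDiffGroupoid ∞ (𝓡 n)) ∧
            (∀ b ∈ B, IsPDOn n b b.source) ∧ (∀ a ∈ A, a.restr U' ∈ B) ∧
            convexHull ℝ (s : Set (EuclideanSpace ℝ (Fin n))) ⊆ ⋃ b ∈ B, b.source)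
    {A' : Set (OpenPartialHomeomorph (EuclideanSpace ℝ (Fin n)) (EuclideanSpace ℝ (Fin n)))}
    (hA' : ∀ a ∈ A', ∀ a' ∈ A', a.symm ≫ₕ a' ∈ contDiffGroupoid ∞ (𝓡 n))
    (hA'pd : ∀ a ∈ A', IsPDOn n a a.source)
    {C : Set (EuclideanSpace ℝ (Fin n))} (hC : IsClosed C) (hCcov : C ⊆ ⋃ a ∈ A', a.source)
    {s : Finset (EuclideanSpace ℝ (Fin n))} (hsne : s.Nonempty)
    (hs : AffineIndependent ℝ ((↑) : s → EuclideanSpace ℝ (Fin n)))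
    (hbd : (⋃ t ∈ s.ssubsets, convexHull ℝ (t : Set (EuclideanSpace ℝ (Fin n)))) ⊆ C)
    (hCs : C ∩ convexHull ℝ (s : Set (EuclideanSpace ℝ (Fin n))) ⊆
      ⋃ t ∈ s.ssubsets, convexHull ℝ (t : Set (EuclideanSpace ℝ (Fin n))))
    {N₀ : Set (EuclideanSpace ℝ (Fin n))} (hN₀ : IsOpen N₀)
    (hsN₀ : convexHull ℝ (s : Set (EuclideanSpace ℝ (Fin n))) ⊆ N₀) :
    ∃ A'' : Set (OpenPartialHomeomorph (EuclideanSpace ℝ (Fin n)) (EuclideanSpace ℝ (Fin n))),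
      (∀ a ∈ A'', ∀ a' ∈ A'', a.symm ≫ₕ a' ∈ contDiffGroupoid ∞ (𝓡 n)) ∧
      (∀ a ∈ A'', IsPDOn n a a.source) ∧
      C ∪ convexHull ℝ (s : Set (EuclideanSpace ℝ (Fin n))) ⊆ (⋃ a ∈ A'', a.source) ∧
      ∃ E : Set (EuclideanSpace ℝ (Fin n)), IsClosed E ∧ E ⊆ N₀ ∧ Disjoint E C ∧
        ∀ a ∈ A', a.restr Eᶜ ∈ A'' := by
  obtain ⟨U', hU'o, hbdU', B, hB, hBpd, hBA, hscov⟩ :=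
    hsimp s hsne hs A' hA' hA'pd (hbd.trans hCcov)
  have hcpt : IsCompact (convexHull ℝ (s : Set (EuclideanSpace ℝ (Fin n)))) :=
    Set.Finite.isCompact_convexHull ℝ s.finite_toSet
  set σ : Set (EuclideanSpace ℝ (Fin n)) := convexHull ℝ (s : Set (EuclideanSpace ℝ (Fin n)))
    with hσ
  -- a thin neighbourhood of the simplex, inside `N₀` and missing `C ∖ U'`
  have hopen : IsOpen (N₀ ∩ (C ∩ U'ᶜ)ᶜ) := hN₀.inter (hC.inter hU'o.isClosed_compl).isOpen_compl
  have hsub : σ ⊆ N₀ ∩ (C ∩ U'ᶜ)ᶜ := fun x hx =>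
    ⟨hsN₀ hx, fun h => h.2 (hbdU' (hCs ⟨h.1, hx⟩))⟩
  obtain ⟨δ, hδ, hδsub⟩ := hcpt.exists_cthickening_subset_open hopen hsub
  set W := thickening δ σ with hW
  set E := cthickening δ σ ∩ U'ᶜ with hE
  have hWo : IsOpen W := isOpen_thickening
  have hsW : σ ⊆ W := self_subset_thickening hδ σ
  have hWE : ∀ {x}, x ∈ W → x ∉ E → x ∈ U' := fun {x} hxW hxE => by
    by_contra hxU
    exact hxE ⟨thickening_subset_cthickening δ σ hxW, hxU⟩
  have hEc : IsClosed E := isClosed_cthickening.inter hU'o.isClosed_compl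
  have hEo : IsOpen Eᶜ := hEc.isOpen_compl
  refine ⟨(fun a : OpenPartialHomeomorph _ _ => a.restr Eᶜ) '' A' ∪
    (fun b : OpenPartialHomeomorph _ _ => b.restr W) '' B, ?_, ?_, ?_, E, hEc,
    fun x hx => (hδsub hx.1).1, disjoint_left.2 fun x hxE hxC => (hδsub hxE.1).2 ⟨hxC, hxE.2⟩,
    fun a ha => Or.inl (mem_image_of_mem _ ha)⟩
  · -- compatibility
    refine groupoidCompatible_union (contDiffGroupoid ∞ (𝓡 n))
      (groupoidCompatible_of_dominated _ hA' ?_) (groupoidCompatible_of_dominated _ hB ?_) ?_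
    · rintro _ ⟨a, ha, rfl⟩
      exact ⟨a, ha, restr_source_subset_and_eqOn a _⟩
    · rintro _ ⟨b, hb, rfl⟩
      exact ⟨b, hb, restr_source_subset_and_eqOn b _⟩
    · rintro _ ⟨a, ha, rfl⟩ _ ⟨b, hb, rfl⟩
      have hmem : (a.restr U').symm ≫ₕ b ∈ contDiffGroupoid ∞ (𝓡 n) := hB _ (hBA a ha) b hb
      refine mem_groupoid_of_eqOn_of_source_subset _ hmem (fun y hy => ?_) fun y _ => rfl
      have hy' : (y ∈ a.target ∧ a.symm y ∈ Eᶜ) ∧ a.symm y ∈ b.source ∧ a.symm y ∈ W := by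
        simpa only [OpenPartialHomeomorph.trans_source, OpenPartialHomeomorph.symm_source,
          OpenPartialHomeomorph.restr_target, OpenPartialHomeomorph.restr_source,
          hEo.interior_eq, hWo.interior_eq, mem_inter_iff, mem_preimage,
          OpenPartialHomeomorph.restr_symm_apply] using hy
      simp only [OpenPartialHomeomorph.trans_source, OpenPartialHomeomorph.symm_source,
        OpenPartialHomeomorph.restr_target, hU'o.interior_eq, mem_inter_iff, mem_preimage,
        OpenPartialHomeomorph.restr_symm_apply]
      exact ⟨⟨hy'.1.1, hWE hy'.2.2 hy'.1.2⟩, hy'.2.1⟩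
  · -- PD
    rintro c (⟨a, ha, rfl⟩ | ⟨b, hb, rfl⟩)
    · exact isPDOn_source_of_eqOn (hA'pd a ha) (restr_source_subset_and_eqOn a _).1
        (restr_source_subset_and_eqOn a _).2
    · exact isPDOn_source_of_eqOn (hBpd b hb) (restr_source_subset_and_eqOn b _).1
        (restr_source_subset_and_eqOn b _).2
  · -- cover
    rintro x (hx | hx)
    · obtain ⟨a, ha, hxa⟩ := mem_iUnion₂.1 (hCcov hx)
      refine mem_iUnion₂.2 ⟨a.restr Eᶜ, Or.inl (mem_image_of_mem _ ha), ?_⟩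
      rw [a.restr_source' _ hEo]
      exact ⟨hxa, fun hxE => Set.disjoint_left.1
        (disjoint_left.2 fun x hxE hxC => (hδsub hxE.1).2 ⟨hxC, hxE.2⟩) hxE hx⟩
    · obtain ⟨b, hb, hxb⟩ := mem_iUnion₂.1 (hscov hx)
      refine mem_iUnion₂.2 ⟨b.restr W, Or.inr (mem_image_of_mem _ hb), ?_⟩
      rw [b.restr_source' _ hWo]
      exact ⟨hxb, hsW hx⟩

end SimplexStep

/-! ### §4 The local step from the simplexwise step -/

section LocalFromSimplex

variable {n : ℕ}

/-- **The local step in `ℝⁿ` follows from the simplexwise step.**  Granted `hsimp` (a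
smoothing family covering the boundary of a simplex agrees near the boundary with one covering
the whole simplex), smoothing families extend from compact `K` over compact `L` with support
in a compact neighbourhood `N` of `L` (the hypothesis `hloc` of
`exists_isManifold_isWhiteheadCompatible_of_localStep`).  Proof: take a fine finite complex
`P` with `L ⊆ |P| ⊆ interior N` all of whose closed simplices meeting `K` lie in
`V = ⋃ sources` (`exists_complex_fine`); the simplices inside `V` form a subcomplex `P₀`,
already covered; process the remaining simplices in order of dimension
(`exists_family_simplex_step`, with `C = K ∪ |P₀| ∪ (lower simplices) ∪ (processed ones)`: a
remaining simplex meets `C` only along its boundary, since it misses `K` and meets other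
simplices of `P` in common proper faces); each step keeps the previous charts off a closed
subset of `interior N`, so at the end the restrictions of the original charts to `Nᶜ` may be
added.  (The induction has the skeletal shape of Munkres (1964), §1, 1.1–1.3.) [folklore] -/
theorem localStep_of_simplexStep
    (hsimp : ∀ s : Finset (EuclideanSpace ℝ (Fin n)), s.Nonempty →
      AffineIndependent ℝ ((↑) : s → EuclideanSpace ℝ (Fin n)) →
      ∀ A : Set (OpenPartialHomeomorph (EuclideanSpace ℝ (Fin n)) (EuclideanSpace ℝ (Fin n))),
        (∀ a ∈ A, ∀ a' ∈ A, a.symm ≫ₕ a' ∈ contDiffGroupoid ∞ (𝓡 n)) →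
        (∀ a ∈ A, IsPDOn n a a.source) →
        (⋃ t ∈ s.ssubsets, convexHull ℝ (t : Set (EuclideanSpace ℝ (Fin n)))) ⊆ ⋃ a ∈ A, a.source →
        ∃ U' : Set (EuclideanSpace ℝ (Fin n)), IsOpen U' ∧
          (⋃ t ∈ s.ssubsets, convexHull ℝ (t : Set (EuclideanSpace ℝ (Fin n)))) ⊆ U' ∧
          ∃ B : Set (OpenPartialHomeomorph (EuclideanSpace ℝ (Fin n)) (EuclideanSpace ℝ (Fin n))),
            (∀ b ∈ B, ∀ b' ∈ B, b.symm ≫ₕ b' ∈ contDiffGroupoid ∞ (𝓡 n)) ∧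
            (∀ b ∈ B, IsPDOn n b b.source) ∧ (∀ a ∈ A, a.restr U' ∈ B) ∧
            convexHull ℝ (s : Set (EuclideanSpace ℝ (Fin n))) ⊆ ⋃ b ∈ B, b.source) :
    ∀ (K L N : Set (EuclideanSpace ℝ (Fin n))), IsCompact K → IsCompact L → IsCompact N →
      L ⊆ interior N →
      ∀ A : Set (OpenPartialHomeomorph (EuclideanSpace ℝ (Fin n)) (EuclideanSpace ℝ (Fin n))),
        (∀ a ∈ A, ∀ a' ∈ A, a.symm ≫ₕ a' ∈ contDiffGroupoid ∞ (𝓡 n)) →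
        (∀ a ∈ A, IsPDOn n a a.source) → K ⊆ ⋃ a ∈ A, a.source →
        ∃ B : Set (OpenPartialHomeomorph (EuclideanSpace ℝ (Fin n)) (EuclideanSpace ℝ (Fin n))),
          (∀ b ∈ B, ∀ b' ∈ B, b.symm ≫ₕ b' ∈ contDiffGroupoid ∞ (𝓡 n)) ∧
          (∀ b ∈ B, IsPDOn n b b.source) ∧ (∀ a ∈ A, a.restr Nᶜ ∈ B) ∧
          K ∪ L ⊆ ⋃ b ∈ B, b.source := by
  intro K L N hK hL hN hLN A hA hApd hKA
  classical
  have hVo : IsOpen (⋃ a ∈ A, a.source) := isOpen_biUnion fun a _ => a.open_source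
  obtain ⟨P, hPfin, hLP, hPN, hgood⟩ := exists_complex_fine hK hVo hKA hL isOpen_interior hLN
  set V := ⋃ a ∈ A, a.source with hV
  -- notation: the closed simplex of a configuration
  have hcvx_closed : ∀ t : Finset (EuclideanSpace ℝ (Fin n)),
      IsClosed (convexHull ℝ (t : Set (EuclideanSpace ℝ (Fin n)))) := fun t =>
    (Set.Finite.isCompact_convexHull ℝ t.finite_toSet).isClosed
  -- the covered set at level `c` after processing `S`
  obtain ⟨Cov, hCov, hCovc⟩ : ∃ Cov : ℕ → Finset (Finset (EuclideanSpace ℝ (Fin n))) →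
      Set (EuclideanSpace ℝ (Fin n)),
      (∀ c S x, x ∈ Cov c S ↔ x ∈ K ∨
        (∃ t ∈ P.faces, convexHull ℝ (t : Set (EuclideanSpace ℝ (Fin n))) ⊆ V ∧
          x ∈ convexHull ℝ (t : Set (EuclideanSpace ℝ (Fin n)))) ∨
        (∃ t ∈ P.faces, t.card < c ∧ x ∈ convexHull ℝ (t : Set (EuclideanSpace ℝ (Fin n)))) ∨
        ∃ t ∈ S, x ∈ convexHull ℝ (t : Set (EuclideanSpace ℝ (Fin n)))) ∧
      ∀ c S, IsClosed (Cov c S) := by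
    refine ⟨fun c S => K ∪ ((⋃ t ∈ {t | t ∈ P.faces ∧
        convexHull ℝ (t : Set (EuclideanSpace ℝ (Fin n))) ⊆ V},
        convexHull ℝ (t : Set (EuclideanSpace ℝ (Fin n)))) ∪
      ((⋃ t ∈ {t | t ∈ P.faces ∧ t.card < c}, convexHull ℝ (t : Set (EuclideanSpace ℝ (Fin n)))) ∪
        ⋃ t ∈ (S : Set (Finset (EuclideanSpace ℝ (Fin n)))),
          convexHull ℝ (t : Set (EuclideanSpace ℝ (Fin n))))), fun c S x => ?_, fun c S => ?_⟩
    · simp only [mem_union, mem_iUnion, mem_setOf_eq, exists_prop, Finset.mem_coe, and_assoc]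
    · refine hK.isClosed.union ((Set.Finite.isClosed_biUnion (hPfin.subset fun t ht => ht.1)
        fun t _ => hcvx_closed t).union ((Set.Finite.isClosed_biUnion
          (hPfin.subset fun t ht => ht.1) fun t _ => hcvx_closed t).union
            (S.finite_toSet.isClosed_biUnion fun t _ => hcvx_closed t)))
  -- the invariant
  let Inv : ℕ → Finset (Finset (EuclideanSpace ℝ (Fin n))) →
      Set (OpenPartialHomeomorph (EuclideanSpace ℝ (Fin n)) (EuclideanSpace ℝ (Fin n))) → Prop :=
    fun c S G =>
      (∀ e ∈ G, ∀ e' ∈ G, e.symm ≫ₕ e' ∈ contDiffGroupoid ∞ (𝓡 n)) ∧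
      (∀ e ∈ G, IsPDOn n e e.source) ∧ Cov c S ⊆ (⋃ e ∈ G, e.source) ∧
      ∀ a ∈ A, ∃ O : Set (EuclideanSpace ℝ (Fin n)), IsOpen O ∧ Nᶜ ⊆ O ∧ a.restr O ∈ G
  -- (b) the start: level `1`, nothing processed, the family `A` itself
  have hbase : ∃ G, Inv 1 ∅ G := by
    refine ⟨A, hA, hApd, fun x hx => ?_, fun a ha => ⟨univ, isOpen_univ, subset_univ _, ?_⟩⟩
    · rcases (hCov 1 ∅ x).1 hx with hxK | ⟨t, -, htV, hxt⟩ | ⟨t, htP, htc, -⟩ | ⟨t, ht, -⟩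
      · exact hKA hxK
      · exact htV hxt
      · exact absurd (Finset.card_pos.2 (Geometry.SimplicialComplex.nonempty_of_mem_faces htP))
          (by omega)
      · exact absurd ht (Finset.notMem_empty t)
    · rw [OpenPartialHomeomorph.restr_univ]
      exact ha
  -- (c) the step over one simplex `σ` of level `c`
  have hstep : ∀ (c : ℕ) (S : Finset (Finset (EuclideanSpace ℝ (Fin n))))
      (σ : Finset (EuclideanSpace ℝ (Fin n))) (G), Inv c S G → σ ∈ P.faces → σ.card = c →
      ¬ convexHull ℝ (σ : Set (EuclideanSpace ℝ (Fin n))) ⊆ V → σ ∉ S →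
      (∀ t ∈ S, t ∈ P.faces ∧ t.card = c) → ∃ G', Inv c (insert σ S) G' := by
    rintro c S σ G ⟨hG, hGpd, hGcov, hGres⟩ hσ hσc hσV hσS hS
    -- where `σ` meets the other relevant simplices
    have key : ∀ t ∈ P.faces, ¬ σ ⊆ t → ∀ x ∈ convexHull ℝ (σ : Set (EuclideanSpace ℝ (Fin n))),
        x ∈ convexHull ℝ (t : Set (EuclideanSpace ℝ (Fin n))) →
        x ∈ ⋃ u ∈ σ.ssubsets, convexHull ℝ (u : Set (EuclideanSpace ℝ (Fin n))) := by
      intro t ht hσt x hxσ hxt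
      have hx : x ∈ convexHull ℝ ((σ ∩ t : Finset _) : Set (EuclideanSpace ℝ (Fin n))) := by
        rw [Finset.coe_inter, ← P.convexHull_inter_convexHull hσ ht]
        exact ⟨hxσ, hxt⟩
      refine mem_iUnion₂.2 ⟨σ ∩ t, Finset.mem_ssubsets.2
        (Finset.ssubset_iff_subset_ne.2 ⟨Finset.inter_subset_left, fun h => hσt ?_⟩), hx⟩
      exact Finset.inter_eq_left.1 h
    have hbd : (⋃ t ∈ σ.ssubsets, convexHull ℝ (t : Set (EuclideanSpace ℝ (Fin n)))) ⊆ Cov c S := by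
      intro x hx
      obtain ⟨t, ht, hxt⟩ := mem_iUnion₂.1 hx
      rw [Finset.mem_ssubsets] at ht
      rcases t.eq_empty_or_nonempty with rfl | htne
      · simp at hxt
      · exact (hCov c S x).2 (Or.inr (Or.inr (Or.inl ⟨t, P.down_closed hσ ht.subset htne,
          hσc ▸ Finset.card_lt_card ht, hxt⟩)))
    have hCs : Cov c S ∩ convexHull ℝ (σ : Set (EuclideanSpace ℝ (Fin n))) ⊆
        ⋃ t ∈ σ.ssubsets, convexHull ℝ (t : Set (EuclideanSpace ℝ (Fin n))) := by
      rintro x ⟨hxC, hxσ⟩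
      rcases (hCov c S x).1 hxC with hxK | ⟨t, htP, htV, hxt⟩ | ⟨t, htP, htc, hxt⟩ | ⟨t, htS, hxt⟩
      · exact absurd (hgood σ hσ ⟨x, hxσ, hxK⟩) hσV
      · exact key t htP (fun h => hσV ((convexHull_mono (by exact_mod_cast h)).trans htV)) x hxσ hxt
      · exact key t htP (fun h => absurd (Finset.card_le_card h) (by omega)) x hxσ hxt
      · obtain ⟨htP, htc⟩ := hS t htS
        refine key t htP (fun h => hσS ?_) x hxσ hxt
        rwa [Finset.eq_of_subset_of_card_le h (by omega)]
    obtain ⟨G', hG', hG'pd, hcov', E, hEc, hEN, -, hres⟩ := exists_family_simplex_step hsimp hG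
      hGpd (hCovc c S) hGcov (Geometry.SimplicialComplex.nonempty_of_mem_faces hσ) (P.indep hσ)
      hbd hCs isOpen_interior ((Geometry.SimplicialComplex.convexHull_subset_space hσ).trans hPN)
    refine ⟨G', hG', hG'pd, fun x hx => ?_, fun a ha => ?_⟩
    · rcases (hCov c (insert σ S) x).1 hx with hxK | ⟨t, htP, htV, hxt⟩ | ⟨t, htP, htc, hxt⟩ |
          ⟨t, ht, hxt⟩
      · exact hcov' (Or.inl ((hCov c S x).2 (Or.inl hxK)))
      · exact hcov' (Or.inl ((hCov c S x).2 (Or.inr (Or.inl ⟨t, htP, htV, hxt⟩))))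
      · exact hcov' (Or.inl ((hCov c S x).2 (Or.inr (Or.inr (Or.inl ⟨t, htP, htc, hxt⟩)))))
      · rcases Finset.mem_insert.1 ht with rfl | htS
        · exact hcov' (Or.inr hxt)
        · exact hcov' (Or.inl ((hCov c S x).2 (Or.inr (Or.inr (Or.inr ⟨t, htS, hxt⟩)))))
    · obtain ⟨O, hO, hNO, haO⟩ := hGres a ha
      refine ⟨O ∩ Eᶜ, hO.inter hEc.isOpen_compl,
        subset_inter hNO (compl_subset_compl.2 (hEN.trans interior_subset)), ?_⟩
      rw [← restr_restr_of_isOpen a hO hEc.isOpen_compl]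
      exact hres _ haO
  -- (d) sweeping one level: process all simplices of cardinality `c` outside `V`
  have hsweep : ∀ c, (∃ G, Inv c ∅ G) →
      ∃ G, Inv c (hPfin.toFinset.filter fun t : Finset (EuclideanSpace ℝ (Fin n)) => t.card = c ∧
        ¬ convexHull ℝ (t : Set (EuclideanSpace ℝ (Fin n))) ⊆ V) G := by
    intro c h0
    set Fc := hPfin.toFinset.filter fun t : Finset (EuclideanSpace ℝ (Fin n)) => t.card = c ∧
        ¬ convexHull ℝ (t : Set (EuclideanSpace ℝ (Fin n))) ⊆ V with hFc
    have hFc_mem : ∀ {t}, t ∈ Fc ↔ t ∈ P.faces ∧ t.card = c ∧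
        ¬ convexHull ℝ (t : Set (EuclideanSpace ℝ (Fin n))) ⊆ V := fun {t} => by
      rw [hFc, Finset.mem_filter, Set.Finite.mem_toFinset]
    suffices h : ∀ S : Finset (Finset (EuclideanSpace ℝ (Fin n))), S ⊆ Fc → ∃ G, Inv c S G from
      h Fc Finset.Subset.rfl
    intro S
    induction S using Finset.induction_on with
    | empty => exact fun _ => h0
    | @insert σ S hσS ih =>
        intro hsub
        obtain ⟨G, hG⟩ := ih ((Finset.subset_insert σ S).trans hsub)
        obtain ⟨hσP, hσc, hσV⟩ := hFc_mem.1 (hsub (Finset.mem_insert_self σ S))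
        exact hstep c S σ G hG hσP hσc hσV hσS fun t ht =>
          ⟨(hFc_mem.1 (hsub (Finset.mem_insert_of_mem ht))).1,
            (hFc_mem.1 (hsub (Finset.mem_insert_of_mem ht))).2.1⟩
  -- (e) passing to the next level
  have hup : ∀ c G, Inv c (hPfin.toFinset.filter fun t : Finset (EuclideanSpace ℝ (Fin n)) => t.card = c ∧
      ¬ convexHull ℝ (t : Set (EuclideanSpace ℝ (Fin n))) ⊆ V) G → Inv (c + 1) ∅ G := by
    rintro c G ⟨hG, hGpd, hGcov, hGres⟩
    refine ⟨hG, hGpd, fun x hx => hGcov ?_, hGres⟩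
    rcases (hCov (c + 1) ∅ x).1 hx with hxK | ⟨t, htP, htV, hxt⟩ | ⟨t, htP, htc, hxt⟩ | ⟨t, ht, -⟩
    · exact (hCov c _ x).2 (Or.inl hxK)
    · exact (hCov c _ x).2 (Or.inr (Or.inl ⟨t, htP, htV, hxt⟩))
    · rcases (Nat.lt_succ_iff.1 htc).lt_or_eq with hlt | heq
      · exact (hCov c _ x).2 (Or.inr (Or.inr (Or.inl ⟨t, htP, hlt, hxt⟩)))
      · by_cases htV : convexHull ℝ (t : Set (EuclideanSpace ℝ (Fin n))) ⊆ V
        · exact (hCov c _ x).2 (Or.inr (Or.inl ⟨t, htP, htV, hxt⟩))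
        · refine (hCov c _ x).2 (Or.inr (Or.inr (Or.inr ⟨t, ?_, hxt⟩)))
          rw [Finset.mem_filter, Set.Finite.mem_toFinset]
          exact ⟨htP, heq, htV⟩
    · exact absurd ht (Finset.notMem_empty t)
  -- (f) all levels
  have hall : ∀ c, 1 ≤ c → ∃ G, Inv c ∅ G := by
    intro c hc
    induction hc with
    | refl => exact hbase
    | step hle ih =>
        obtain ⟨G, hG⟩ := hsweep _ ih
        exact ⟨G, hup _ G hG⟩
  -- (g) beyond the top level everything is covered; add the restrictions to `Nᶜ`
  obtain ⟨G, hG, hGpd, hGcov, hGres⟩ := hall (hPfin.toFinset.sup Finset.card + 1) (by omega)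
  have hNo : IsOpen Nᶜ := hN.isClosed.isOpen_compl
  refine ⟨G ∪ (fun a : OpenPartialHomeomorph _ _ => a.restr Nᶜ) '' A, ?_, ?_,
    fun a ha => Or.inr (mem_image_of_mem _ ha), ?_⟩
  · refine groupoidCompatible_of_dominated _ hG ?_
    rintro b (hb | ⟨a, ha, rfl⟩)
    · exact ⟨b, hb, Subset.rfl, fun _ _ => rfl⟩
    · obtain ⟨O, hO, hNO, haO⟩ := hGres a ha
      refine ⟨a.restr O, haO, ?_, fun _ _ => rfl⟩
      rw [a.restr_source' _ hNo, a.restr_source' _ hO]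
      exact inter_subset_inter_right _ hNO
  · rintro b (hb | ⟨a, ha, rfl⟩)
    · exact hGpd b hb
    · exact isPDOn_source_of_eqOn (hApd a ha) (restr_source_subset_and_eqOn a _).1
        (restr_source_subset_and_eqOn a _).2
  · intro x hx
    have hx' : x ∈ Cov (hPfin.toFinset.sup Finset.card + 1) ∅ := by
      rcases hx with hxK | hxL
      · exact (hCov _ _ x).2 (Or.inl hxK)
      · obtain ⟨t, ht, hxt⟩ :=
          Geometry.SimplicialComplex.mem_space_iff.1 (interior_subset (hLP hxL))
        refine (hCov _ _ x).2 (Or.inr (Or.inr (Or.inl ⟨t, ht, ?_, hxt⟩)))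
        exact Nat.lt_succ_of_le
          (Finset.le_sup (f := Finset.card) ((Set.Finite.mem_toFinset hPfin).2 ht))
    exact biUnion_subset_biUnion_left subset_union_left (hGcov hx')

end LocalFromSimplex

/-! ### §5 Vertices are free; the reductions assembled -/

section Vertices

variable {H : Type*} [TopologicalSpace H] (G : StructureGroupoid H)

/-- A partial homeomorphism of the model with empty source belongs to every structure
groupoid (it lies in the trivial groupoid `idGroupoid = ⊥`). [folklore] -/
theorem mem_groupoid_of_source_eq_empty {T : OpenPartialHomeomorph H H} (h : T.source = ∅) :
    T ∈ G :=
  StructureGroupoid.le_iff.1 bot_le T (show T ∈ idGroupoid H from Or.inr h)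

variable {n : ℕ}

/-- **The simplexwise step at a vertex is free** (no obstruction below dimension `0`): for a
one-point configuration the boundary is empty, and the family of the old charts restricted to
`∅` together with the identity chart of `ℝⁿ` does it. [folklore] -/
theorem simplexStep_of_card_eq_one {s : Finset (EuclideanSpace ℝ (Fin n))} (hs : s.card = 1)
    (A : Set (OpenPartialHomeomorph (EuclideanSpace ℝ (Fin n)) (EuclideanSpace ℝ (Fin n)))) :
    ∃ U' : Set (EuclideanSpace ℝ (Fin n)), IsOpen U' ∧
      (⋃ t ∈ s.ssubsets, convexHull ℝ (t : Set (EuclideanSpace ℝ (Fin n)))) ⊆ U' ∧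
      ∃ B : Set (OpenPartialHomeomorph (EuclideanSpace ℝ (Fin n)) (EuclideanSpace ℝ (Fin n))),
        (∀ b ∈ B, ∀ b' ∈ B, b.symm ≫ₕ b' ∈ contDiffGroupoid ∞ (𝓡 n)) ∧
        (∀ b ∈ B, IsPDOn n b b.source) ∧ (∀ a ∈ A, a.restr U' ∈ B) ∧
        convexHull ℝ (s : Set (EuclideanSpace ℝ (Fin n))) ⊆ ⋃ b ∈ B, b.source := by
  obtain ⟨v, rfl⟩ := Finset.card_eq_one.1 hs
  have hres : ∀ a : OpenPartialHomeomorph (EuclideanSpace ℝ (Fin n)) (EuclideanSpace ℝ (Fin n)),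
      (a.restr ∅).source = ∅ := fun a => by
    rw [a.restr_source' _ isOpen_empty, inter_empty]
  refine ⟨∅, isOpen_empty, ?_, insert (OpenPartialHomeomorph.refl _)
    ((fun a : OpenPartialHomeomorph _ _ => a.restr ∅) '' A), ?_, ?_,
    fun a ha => mem_insert_of_mem _ (mem_image_of_mem _ ha), ?_⟩
  · intro x hx
    obtain ⟨t, ht, hxt⟩ := mem_iUnion₂.1 hx
    rw [Finset.mem_ssubsets, Finset.ssubset_singleton_iff] at ht
    subst ht
    simp at hxt
  · rintro b (rfl | ⟨a, ha, rfl⟩) b' (rfl | ⟨a', ha', rfl⟩)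
    · rw [OpenPartialHomeomorph.refl_symm, OpenPartialHomeomorph.refl_trans]
      exact StructureGroupoid.id_mem _
    · refine mem_groupoid_of_source_eq_empty _ (eq_empty_of_forall_notMem fun y hy => ?_)
      rw [OpenPartialHomeomorph.trans_source, mem_inter_iff, mem_preimage, hres] at hy
      exact hy.2
    · refine mem_groupoid_of_source_eq_empty _ (eq_empty_of_forall_notMem fun y hy => ?_)
      rw [OpenPartialHomeomorph.trans_source, OpenPartialHomeomorph.symm_source] at hy
      have h := (a.restr ∅).map_target hy.1
      rw [hres] at h
      exact h
    · refine mem_groupoid_of_source_eq_empty _ (eq_empty_of_forall_notMem fun y hy => ?_)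
      rw [OpenPartialHomeomorph.trans_source, OpenPartialHomeomorph.symm_source] at hy
      have h := (a.restr ∅).map_target hy.1
      rw [hres] at h
      exact h
  · rintro b (rfl | ⟨a, ha, rfl⟩)
    · exact isPDOn_id isOpen_univ
    · rw [hres]
      exact fun x hx => (notMem_empty x hx).elim
  · intro x _
    exact mem_iUnion₂.2 ⟨OpenPartialHomeomorph.refl _, mem_insert _ _, mem_univ x⟩

/-- The simplexwise step for all simplices follows from the simplexwise step for simplices of
positive dimension (`simplexStep_of_card_eq_one`). [folklore] -/
theorem simplexStep_of_two_le
    (hsimp : ∀ s : Finset (EuclideanSpace ℝ (Fin n)), 2 ≤ s.card →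
      AffineIndependent ℝ ((↑) : s → EuclideanSpace ℝ (Fin n)) →
      ∀ A : Set (OpenPartialHomeomorph (EuclideanSpace ℝ (Fin n)) (EuclideanSpace ℝ (Fin n))),
        (∀ a ∈ A, ∀ a' ∈ A, a.symm ≫ₕ a' ∈ contDiffGroupoid ∞ (𝓡 n)) →
        (∀ a ∈ A, IsPDOn n a a.source) →
        (⋃ t ∈ s.ssubsets, convexHull ℝ (t : Set (EuclideanSpace ℝ (Fin n)))) ⊆ ⋃ a ∈ A, a.source →
        ∃ U' : Set (EuclideanSpace ℝ (Fin n)), IsOpen U' ∧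
          (⋃ t ∈ s.ssubsets, convexHull ℝ (t : Set (EuclideanSpace ℝ (Fin n)))) ⊆ U' ∧
          ∃ B : Set (OpenPartialHomeomorph (EuclideanSpace ℝ (Fin n)) (EuclideanSpace ℝ (Fin n))),
            (∀ b ∈ B, ∀ b' ∈ B, b.symm ≫ₕ b' ∈ contDiffGroupoid ∞ (𝓡 n)) ∧
            (∀ b ∈ B, IsPDOn n b b.source) ∧ (∀ a ∈ A, a.restr U' ∈ B) ∧
            convexHull ℝ (s : Set (EuclideanSpace ℝ (Fin n))) ⊆ ⋃ b ∈ B, b.source) :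
    ∀ s : Finset (EuclideanSpace ℝ (Fin n)), s.Nonempty →
      AffineIndependent ℝ ((↑) : s → EuclideanSpace ℝ (Fin n)) →
      ∀ A : Set (OpenPartialHomeomorph (EuclideanSpace ℝ (Fin n)) (EuclideanSpace ℝ (Fin n))),
        (∀ a ∈ A, ∀ a' ∈ A, a.symm ≫ₕ a' ∈ contDiffGroupoid ∞ (𝓡 n)) →
        (∀ a ∈ A, IsPDOn n a a.source) →
        (⋃ t ∈ s.ssubsets, convexHull ℝ (t : Set (EuclideanSpace ℝ (Fin n)))) ⊆ ⋃ a ∈ A, a.source →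
        ∃ U' : Set (EuclideanSpace ℝ (Fin n)), IsOpen U' ∧
          (⋃ t ∈ s.ssubsets, convexHull ℝ (t : Set (EuclideanSpace ℝ (Fin n)))) ⊆ U' ∧
          ∃ B : Set (OpenPartialHomeomorph (EuclideanSpace ℝ (Fin n)) (EuclideanSpace ℝ (Fin n))),
            (∀ b ∈ B, ∀ b' ∈ B, b.symm ≫ₕ b' ∈ contDiffGroupoid ∞ (𝓡 n)) ∧
            (∀ b ∈ B, IsPDOn n b b.source) ∧ (∀ a ∈ A, a.restr U' ∈ B) ∧
            convexHull ℝ (s : Set (EuclideanSpace ℝ (Fin n))) ⊆ ⋃ b ∈ B, b.source := by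
  intro s hsne hs A hA hApd hbd
  rcases Nat.lt_or_ge s.card 2 with hlt | hge
  · exact simplexStep_of_card_eq_one (by have := Finset.card_pos.2 hsne; omega) A
  · exact hsimp s hge hs A hA hApd hbd

end Vertices

section Assembly

variable {n : ℕ} {M : Type*} [TopologicalSpace M] [T2Space M] [SecondCountableTopology M]
variable (hcomp : IsPLOn.comp (n := n)) (haff : isPLOn_affineMap (n := n) (m := n))

/-- **Smoothability of PL `n`-manifolds from the simplexwise step in `ℝⁿ`**: if, for every
simplex of positive dimension in `ℝⁿ`, every smoothing family covering its boundary agrees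
near the boundary with a smoothing family covering the simplex, then every Hausdorff
second-countable PL `n`-manifold carries a `C^∞` structure with which its PL structure is
Whitehead compatible (`simplexStep_of_two_le`, `localStep_of_simplexStep`,
`exists_isManifold_isWhiteheadCompatible_of_localStep`).  For `n ≤ 7` the hypothesis holds by
the relative smoothing theorem of Hirsch–Mazur (1974), Part II, §5, Thm. 5.3 and the remark
following it (`PL/O` is `6`-connected); it is NOT proved here.
[cite: HirschMazur1974, Part II, §5, Thm 5.3] -/
theorem exists_isManifold_isWhiteheadCompatible_of_simplexStep
    [cPL : ChartedSpace (EuclideanSpace ℝ (Fin n)) M] [IsPLManifold n hcomp haff M]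
    (hsimp : ∀ s : Finset (EuclideanSpace ℝ (Fin n)), 2 ≤ s.card →
      AffineIndependent ℝ ((↑) : s → EuclideanSpace ℝ (Fin n)) →
      ∀ A : Set (OpenPartialHomeomorph (EuclideanSpace ℝ (Fin n)) (EuclideanSpace ℝ (Fin n))),
        (∀ a ∈ A, ∀ a' ∈ A, a.symm ≫ₕ a' ∈ contDiffGroupoid ∞ (𝓡 n)) →
        (∀ a ∈ A, IsPDOn n a a.source) →
        (⋃ t ∈ s.ssubsets, convexHull ℝ (t : Set (EuclideanSpace ℝ (Fin n)))) ⊆ ⋃ a ∈ A, a.source →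
        ∃ U' : Set (EuclideanSpace ℝ (Fin n)), IsOpen U' ∧
          (⋃ t ∈ s.ssubsets, convexHull ℝ (t : Set (EuclideanSpace ℝ (Fin n)))) ⊆ U' ∧
          ∃ B : Set (OpenPartialHomeomorph (EuclideanSpace ℝ (Fin n)) (EuclideanSpace ℝ (Fin n))),
            (∀ b ∈ B, ∀ b' ∈ B, b.symm ≫ₕ b' ∈ contDiffGroupoid ∞ (𝓡 n)) ∧
            (∀ b ∈ B, IsPDOn n b b.source) ∧ (∀ a ∈ A, a.restr U' ∈ B) ∧
            convexHull ℝ (s : Set (EuclideanSpace ℝ (Fin n))) ⊆ ⋃ b ∈ B, b.source) :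
    ∃ cDIFF : ChartedSpace (EuclideanSpace ℝ (Fin n)) M,
      @IsManifold ℝ _ _ _ _ _ _ (𝓡 n) ∞ M _ cDIFF ∧ IsWhiteheadCompatible n M cPL cDIFF :=
  exists_isManifold_isWhiteheadCompatible_of_localStep hcomp haff
    (localStep_of_simplexStep (simplexStep_of_two_le hsimp))

end Assembly

section Four

universe u

variable (hcomp : IsPLOn.comp (n := 4)) (haff : isPLOn_affineMap (n := 4) (m := 4))

/-- **spc4.S35 (existence) follows from the simplexwise step in `ℝ⁴`** for simplices of
dimension `1 ≤ k ≤ 4`: the statement that a smoothing family of an open subset of `ℝ⁴`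
covering the boundary of a `k`-simplex agrees, near the boundary, with one covering the
simplex — true by the relative smoothing theorem of Hirsch–Mazur (1974), Part II, §5, Thm. 5.3
and the remark following it, the relative obstructions lying in `Hⁱ(M, A; πᵢ₋₁(PL/O)) = 0`
(`π₀ = π₁ = π₂ = 0` classically, `π₃(PL/O) = Γ₃ = 0` by Smale 1959 / Munkres 1960), but not
proved here — implies `exists_isManifold_isWhiteheadCompatible_four`
(`exists_isManifold_isWhiteheadCompatible_of_simplexStep`).
[cite: HirschMazur1974, Part II, §5, Thm 5.3] -/
theorem exists_isManifold_isWhiteheadCompatible_four_of_simplexStep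
    (hsimp : ∀ s : Finset (EuclideanSpace ℝ (Fin 4)), 2 ≤ s.card →
      AffineIndependent ℝ ((↑) : s → EuclideanSpace ℝ (Fin 4)) →
      ∀ A : Set (OpenPartialHomeomorph (EuclideanSpace ℝ (Fin 4)) (EuclideanSpace ℝ (Fin 4))),
        (∀ a ∈ A, ∀ a' ∈ A, a.symm ≫ₕ a' ∈ contDiffGroupoid ∞ (𝓡 4)) →
        (∀ a ∈ A, IsPDOn 4 a a.source) →
        (⋃ t ∈ s.ssubsets, convexHull ℝ (t : Set (EuclideanSpace ℝ (Fin 4)))) ⊆ ⋃ a ∈ A, a.source →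
        ∃ U' : Set (EuclideanSpace ℝ (Fin 4)), IsOpen U' ∧
          (⋃ t ∈ s.ssubsets, convexHull ℝ (t : Set (EuclideanSpace ℝ (Fin 4)))) ⊆ U' ∧
          ∃ B : Set (OpenPartialHomeomorph (EuclideanSpace ℝ (Fin 4)) (EuclideanSpace ℝ (Fin 4))),
            (∀ b ∈ B, ∀ b' ∈ B, b.symm ≫ₕ b' ∈ contDiffGroupoid ∞ (𝓡 4)) ∧
            (∀ b ∈ B, IsPDOn 4 b b.source) ∧ (∀ a ∈ A, a.restr U' ∈ B) ∧
            convexHull ℝ (s : Set (EuclideanSpace ℝ (Fin 4))) ⊆ ⋃ b ∈ B, b.source) :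
    exists_isManifold_isWhiteheadCompatible_four.{u} hcomp haff := by
  intro M _ _ _ cPL hPL
  exact exists_isManifold_isWhiteheadCompatible_of_simplexStep hcomp haff hsimp

end Four

end Literature.Topology.FourManifolds
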